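import Summits.CriticalPhenomena.SAWScalingLimit.Theses.SAWImaginaryGeometry
import Summits.CriticalPhenomena.SAWScalingLimit.Theorems.SAWReversalUpgradeLawEventuallyProbability

/-!
# `LawEventuallyProb` (stmt-CriticalPhenomena-10942): eventual well-posedness of the critical SAW law, for `SAWImaginaryGeometry`

Support item stmt-CriticalPhenomena-10942 of route `SAWImaginaryGeometry`: for every Dobrushin domain and endpoint
approximation, the critical SAW law `SAW.law D.carrier δ (a δ) (b δ)` is a probability measure for all small `δ > 0`
(the endpoints are joined for small `δ`, so the normalised weight is a probability).  Syntactically the statement of the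
sibling route's item `SAWReversalUpgrade.LawEventuallyProbability` (stmt-CriticalPhenomena-18011, proved), whose proof
`Theorems.LawEventuallyProbability_proof` is reused by name.
-/

namespace Summit.CriticalPhenomena.SAWScalingLimit.Theorems

open Summit.CriticalPhenomena.SAWScalingLimit.Theses

/-- **`LawEventuallyProb` (stmt-CriticalPhenomena-10942)** of route `SAWImaginaryGeometry`: the critical SAW law is
eventually (in the mesh) a probability measure — the proved twin `LawEventuallyProbability_proof`. [folklore] -/
theorem IGLawEventuallyProb_proof : SAWImaginaryGeometry.LawEventuallyProb :=
  fun D a b hab => LawEventuallyProbability_proof D a b hab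

end Summit.CriticalPhenomena.SAWScalingLimit.Theorems
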